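import Summits.QuantumFields.YangMills.Theorems.LangevinControlUVOSLegsFromFemtoAndGapStubAssemblyFlatDecay
import Literature.MathematicalPhysics.QuantumLattice.LatticeScalarField
import Literature.Probability.LatticeModels.ThermodynamicLimit
import HarnessLib

/-!
# Soft OS-assembly toolkit VI-b (preparations): lattice/physical geometry and the weight bookkeeping

Helper file for stub `stub_assembly` of crux `OSLegsFromFemtoAndGap` (stmt-QuantumFields-9367): elementary
inequalities used by the `a`-uniform bound on the lattice `n`-point distributions —
* `abs_coord_le_norm_siteToE`, `mul_norm_le_norm_smul_siteToE`, `norm_smul_siteToE_sub_le` — the physical position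
  `a • siteToE z ∈ ℝ⁴` of a site dominates `a ‖z‖_∞` and physical Euclidean separations are at most `2a` times
  the lattice sup-separation;
* `norm_mul_one_add_pow_le` — `‖F y‖ ≤ A` and `‖y‖^q ‖F y‖ ≤ B` give `‖F y‖ (1+‖y‖)^q ≤ 2^q (A + B)`;
* `inv_one_add_norm_pow_le_prod` — `((1+‖y‖)⁶)⁻ⁿ ≤ ∏ᵢ ((1 + a‖xᵢ‖)⁶)⁻¹` for `y = a • siteToE ∘ x`;
* `valMinAbs_intCast_of_abs_le` — no wrap-around for coordinate differences of absolute value `≤ L` on the torus of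
  side `2L+1`.
-/

noncomputable section

open scoped BigOperators
open Literature.MathematicalPhysics.QuantumLattice
open Literature.Probability.LatticeModels (Site)

namespace Summit.QuantumFields.YangMills.Theorems.OSLegsFromFemtoAndGap

/-! ### Sites and their physical positions -/

/-- A coordinate of a site is bounded by the Euclidean norm of its position. -/
theorem abs_coord_le_norm_siteToE (z : Site 4) (k : Fin 4) : |(z k : ℝ)| ≤ ‖siteToE z‖ := by
  rw [EuclideanSpace.norm_eq]
  have hk : (z k : ℝ) ^ 2 ≤ ∑ i, ‖siteToE z i‖ ^ 2 := by
    have : ‖siteToE z k‖ ^ 2 ≤ ∑ i, ‖siteToE z i‖ ^ 2 :=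
      Finset.single_le_sum (f := fun i => ‖siteToE z i‖ ^ 2) (fun i _ => by positivity) (Finset.mem_univ k)
    simpa [siteToE_apply, Real.norm_eq_abs, sq_abs] using this
  calc |(z k : ℝ)| = Real.sqrt ((z k : ℝ) ^ 2) := (Real.sqrt_sq_eq_abs _).symm
    _ ≤ Real.sqrt (∑ i, ‖siteToE z i‖ ^ 2) := Real.sqrt_le_sqrt hk

/-- `a ‖z‖_∞ ≤ ‖a • siteToE z‖` for `0 ≤ a` (sup norm of `z : Fin 4 → ℤ`). -/
theorem mul_norm_le_norm_smul_siteToE {a : ℝ} (ha : 0 ≤ a) (z : Site 4) : a * ‖z‖ ≤ ‖a • siteToE z‖ := by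
  rw [norm_smul, Real.norm_of_nonneg ha]
  refine mul_le_mul_of_nonneg_left ?_ ha
  refine (pi_norm_le_iff_of_nonneg (norm_nonneg _)).2 fun k => ?_
  rw [Int.norm_eq_abs]
  exact abs_coord_le_norm_siteToE z k

/-- `siteToE` is additive: `siteToE (z - w) = siteToE z - siteToE w`. -/
theorem siteToE_sub (z w : Site 4) : siteToE (z - w) = siteToE z - siteToE w := by
  ext i
  simp [siteToE_apply]

/-- Physical Euclidean separations are at most `2a` times lattice sup-separations. -/
theorem norm_smul_siteToE_sub_le {a : ℝ} (ha : 0 ≤ a) (z w : Site 4) :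
    ‖a • siteToE z - a • siteToE w‖ ≤ 2 * a * ‖z - w‖ := by
  rw [← smul_sub, norm_smul, Real.norm_of_nonneg ha, ← siteToE_sub]
  rw [mul_comm 2 a, mul_assoc]
  refine mul_le_mul_of_nonneg_left ?_ ha
  rw [EuclideanSpace.norm_eq]
  have hterm : ∀ i, ‖siteToE (z - w) i‖ ^ 2 ≤ ‖z - w‖ ^ 2 := fun i => by
    have h1 : |((z - w) i : ℝ)| ≤ ‖z - w‖ := by
      have := norm_le_pi_norm (z - w) i
      rw [Int.norm_eq_abs] at this
      exact_mod_cast this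
    rw [siteToE_apply, Real.norm_eq_abs]
    exact pow_le_pow_left₀ (abs_nonneg _) h1 2
  have hsum : ∑ i, ‖siteToE (z - w) i‖ ^ 2 ≤ 4 * ‖z - w‖ ^ 2 := by
    calc ∑ i, ‖siteToE (z - w) i‖ ^ 2 ≤ ∑ _i : Fin 4, ‖z - w‖ ^ 2 := Finset.sum_le_sum fun i _ => hterm i
      _ = 4 * ‖z - w‖ ^ 2 := by simp
  calc Real.sqrt (∑ i, ‖siteToE (z - w) i‖ ^ 2) ≤ Real.sqrt (4 * ‖z - w‖ ^ 2) := Real.sqrt_le_sqrt hsum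
    _ = 2 * ‖z - w‖ := by
        rw [show (4 : ℝ) * ‖z - w‖ ^ 2 = (2 * ‖z - w‖) ^ 2 by ring]
        exact Real.sqrt_sq (by positivity)

/-! ### Weight bookkeeping -/

/-- `‖F y‖ ≤ A` and `‖y‖^q ‖F y‖ ≤ B` give `‖F y‖ (1 + ‖y‖)^q ≤ 2^q (A + B)`. -/
theorem norm_mul_one_add_pow_le {V : Type*} [NormedAddCommGroup V] {v : ℂ} {y : V} {A B : ℝ} {q : ℕ}
    (hA : ‖v‖ ≤ A) (hB : ‖y‖ ^ q * ‖v‖ ≤ B) : ‖v‖ * (1 + ‖y‖) ^ q ≤ 2 ^ q * (A + B) := by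
  have hA0 : 0 ≤ A := (norm_nonneg _).trans hA
  have hB0 : 0 ≤ B := le_trans (by positivity) hB
  have hpow : (1 + ‖y‖) ^ q ≤ 2 ^ q * (1 + ‖y‖ ^ q) := by
    have h1 : 1 + ‖y‖ ≤ 2 * max 1 ‖y‖ := by
      rcases le_total 1 ‖y‖ with h | h
      · rw [max_eq_right h]; linarith
      · rw [max_eq_left h]; linarith
    calc (1 + ‖y‖) ^ q ≤ (2 * max 1 ‖y‖) ^ q := pow_le_pow_left₀ (by positivity) h1 q
      _ = 2 ^ q * (max 1 ‖y‖) ^ q := mul_pow _ _ _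
      _ ≤ 2 ^ q * (1 + ‖y‖ ^ q) := by
          gcongr
          rcases le_total 1 ‖y‖ with h | h
          · rw [max_eq_right h]; linarith [pow_nonneg (norm_nonneg y) q, show (0:ℝ) ≤ 1 from zero_le_one]
          · rw [max_eq_left h, one_pow]; linarith [pow_nonneg (norm_nonneg y) q]
  calc ‖v‖ * (1 + ‖y‖) ^ q ≤ ‖v‖ * (2 ^ q * (1 + ‖y‖ ^ q)) := by gcongr
    _ = 2 ^ q * (‖v‖ + ‖y‖ ^ q * ‖v‖) := by ring
    _ ≤ 2 ^ q * (A + B) := by gcongr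

/-- `((1+‖y‖)⁶)⁻¹ⁿ ≤ ∏ᵢ ((1 + a‖xᵢ‖)⁶)⁻¹` when every `‖y i‖ ≥ a ‖x i‖` (e.g. `y i = a • siteToE (x i)`). -/
theorem inv_one_add_norm_pow_le_prod {n : ℕ} {a : ℝ} (ha : 0 ≤ a) (x : Fin n → Site 4)
    (y : Fin n → EuclideanSpace ℝ (Fin 4)) (hy : ∀ i, a * ‖x i‖ ≤ ‖y i‖) (p : ℕ) :
    (((1 + ‖y‖) ^ p)⁻¹) ^ n ≤ ∏ i, ((1 + a * ‖x i‖) ^ p)⁻¹ := by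
  calc (((1 + ‖y‖) ^ p)⁻¹) ^ n = ∏ _i : Fin n, ((1 + ‖y‖) ^ p)⁻¹ := by simp
    _ ≤ ∏ i, ((1 + a * ‖x i‖) ^ p)⁻¹ := Finset.prod_le_prod (fun _ _ => by positivity) fun i _ => by
        have hi : 1 + a * ‖x i‖ ≤ 1 + ‖y‖ := by linarith [hy i, norm_le_pi_norm y i]
        exact inv_anti₀ (by positivity) (pow_le_pow_left₀ (by positivity) hi p)

/-! ### No wrap-around below half the period -/

/-- On the torus `ℤ/(2L+1)` an integer of absolute value `≤ L` is its own minimal representative. -/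
theorem valMinAbs_intCast_of_abs_le {L : ℕ} {d : ℤ} (hd : |d| ≤ L) :
    (((d : ZMod (2 * L + 1))).valMinAbs : ℤ) = d := by
  have hn : (0 : ℕ) < 2 * L + 1 := Nat.succ_pos _
  haveI : NeZero (2 * L + 1) := ⟨by omega⟩
  -- both are representatives of the same class in the window `(-(2L+1)/2, (2L+1)/2]`
  have h1 : ((((d : ZMod (2 * L + 1))).valMinAbs : ℤ) : ZMod (2 * L + 1)) = (d : ZMod (2 * L + 1)) :=
    ZMod.coe_valMinAbs _
  have h2 := ZMod.valMinAbs_mem_Ioc (d : ZMod (2 * L + 1))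
  -- difference is a multiple of `2L+1` of absolute value `< 2L+1`
  have hdvd : ((2 * L + 1 : ℕ) : ℤ) ∣ ((d : ZMod (2 * L + 1))).valMinAbs - d := by
    rw [← ZMod.intCast_zmod_eq_zero_iff_dvd]
    push_cast
    simp
  obtain ⟨c, hc⟩ := hdvd
  have habs := abs_le.1 hd
  rw [Set.mem_Ioc] at h2
  have hlo := h2.1
  have hhi := h2.2
  -- bound `c`
  have hc0 : c = 0 := by
    have hN : (0 : ℤ) < ((2 * L + 1 : ℕ) : ℤ) := by exact_mod_cast hn
    have hup : ((2 * L + 1 : ℕ) : ℤ) * c < ((2 * L + 1 : ℕ) : ℤ) * 1 := by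
      rw [← hc]; push_cast at hhi ⊢; omega
    have hdown : ((2 * L + 1 : ℕ) : ℤ) * (-1) < ((2 * L + 1 : ℕ) : ℤ) * c := by
      rw [← hc]; push_cast at hlo ⊢; omega
    have h3 : c < 1 := lt_of_mul_lt_mul_left hup hN.le
    have h4 : -1 < c := lt_of_mul_lt_mul_left hdown hN.le
    omega
  rw [hc0, mul_zero, sub_eq_zero] at hc
  exact hc

end Summit.QuantumFields.YangMills.Theorems.OSLegsFromFemtoAndGap

end
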